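import Literature.MathematicalPhysics.QuantumFieldTheory.Balaban1983to89.B11Thm1ExistsUniqueCoP7MG

/-!
# `Balaban1983to89.B11Thm1ExistsUniqueCoP7MGBridges` — [Balaban1985Variational] = «[15]», Theorem 1 p. 279 (existence ∕ uniqueness half): THE BOOKKEEPING BRIDGES between the
# floor-free named fact `B11Thm1ExistsUniqueCoP7M.VariationalThm1EUSep{Top,CoP}7M` (✓p740853) and its guard-generic twin `B11Thm1ExistsUniqueCoP7MG.VariationalThm1EUSep{Top,CoP}7MG`

Honest framing: statement-level skeleton of published theorems with citation tags; proofs where landed; nothing here is a claim about the Yang–Mills mass gap.  Cell `pub-ymgap`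
(HUMAN RULINGS D-0062 ∕ D-0149), lane `pub-ymgap-dag-n12-c` g30 (R134 seat (a), N12 = [B15], s1); count-neutral; `--kind proof --supports` K1⁹ `stmt-QuantumFields-27364`; N12 NOT
discharged; finite 𝕋⁴ at fixed ε; nothing continuum ∕ ℝ⁴ ∕ OS ∕ mass-gap ∕ Clay.  THEOREMS ONLY (0 `def`, 0 `instance`, 0 `sorry`) — exactly the bridges K0⁷'s
`Node00/Record12BgRowCoClassCPMFloor` §4 carries for the guarded (8)-token `VariationalThm1RegSepTop7MG` (`toG`, `of_le`), plus antitonicity in the guard and the trivial-guard identity,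
kept OUT of the named-fact module so that one stays in the statement-only lane.

CONTENTS.  `VariationalThm1EUSepTop7M.toG` ∕ `VariationalThm1EUSepCoP7M.toG` (floor-free ⇒ guarded, every guard: drop the antecedent — «floor-free ⇒ guarded, not conversely»);
`VariationalThm1EUSepTop7MG.of_le` ∕ `…CoP7MG.of_le` (antitone in the ceilings `a₀`, `a₁`); `VariationalThm1EUSepTop7MG.anti` ∕ `…CoP7MG.anti` (antitone in the guard: a fact under a
WEAKER guard serves every STRONGER guard); `variationalThm1EUSepTop7MG_true_iff` ∕ `variationalThm1EUSepCoP7MG_true_iff` (the trivial guard IS the floor-free fact).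

HONEST SCOPE.  Implications between two NAMED `Prop`s neither of which is asserted or produced in the tree (an N07 ∕ NODE-00 obligation: [15] Props 2–9); nothing of Bałaban's asserted;
count-neutral; K0⁷ ∕ K1⁹ NOT closed; the YM mass gap (Clay) is NOT proved by any of this.
-/

noncomputable section

namespace Literature.MathematicalPhysics.QuantumFieldTheory.Balaban1983to89.B11Thm1ExistsUniqueCoP7MG

open T4Continuum B15DeterminingSets GaugeField Node00

section Bridges

variable {F : T4Family} {N : ℕ} [NeZero N]

/-- Floor-free (`B11Thm1ExistsUniqueCoP7M.VariationalThm1EUSepTop7M`) ⇒ guarded, every guard (drop the antecedent). [cite: Balaban1985Variational, Thm 1 p.279 (bookkeeping)] -/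
theorem _root_.Literature.MathematicalPhysics.QuantumFieldTheory.Balaban1983to89.B11Thm1ExistsUniqueCoP7M.VariationalThm1EUSepTop7M.toG
    {Sup : (ν : Stage7Numerics) → (K : ℕ) → (ℕ → Set (Site (F.P K) 0)) → Set (Site (F.P K) 0)} {B₃ a₀ a₁ : ℝ}
    (h : B11Thm1ExistsUniqueCoP7M.VariationalThm1EUSepTop7M F N Sup B₃ a₀ a₁) (Adm : StepGuard F) : VariationalThm1EUSepTop7MG F N Sup Adm B₃ a₀ a₁ :=
  fun ν M g K k s hk hsep hM₁ _ => h ν M g K k s hk hsep hM₁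

/-- Floor-free `CoP` fact ⇒ guarded `CoP` fact, every guard. [cite: Balaban1985Variational, Thm 1 p.279 (bookkeeping)] -/
theorem _root_.Literature.MathematicalPhysics.QuantumFieldTheory.Balaban1983to89.B11Thm1ExistsUniqueCoP7M.VariationalThm1EUSepCoP7M.toG {B₃ a₀ a₁ : ℝ}
    (h : B11Thm1ExistsUniqueCoP7M.VariationalThm1EUSepCoP7M F N B₃ a₀ a₁) (Adm : StepGuard F) : VariationalThm1EUSepCoP7MG F N Adm B₃ a₀ a₁ :=
  B11Thm1ExistsUniqueCoP7M.VariationalThm1EUSepTop7M.toG h Adm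

/-- The guarded top-domain fact is ANTITONE in the ceilings `a₀`, `a₁`. [cite: Balaban1985Variational, Thm 1 p.279 (the range «ε₀ ≤ a₀», «ε₁ ≤ a₁»; bookkeeping)] -/
theorem VariationalThm1EUSepTop7MG.of_le {Sup : (ν : Stage7Numerics) → (K : ℕ) → (ℕ → Set (Site (F.P K) 0)) → Set (Site (F.P K) 0)} {Adm : StepGuard F}
    {B₃ a₀ a₀' a₁ a₁' : ℝ} (h : VariationalThm1EUSepTop7MG F N Sup Adm B₃ a₀ a₁) (ha₀ : a₀' ≤ a₀) (ha₁ : a₁' ≤ a₁) :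
    VariationalThm1EUSepTop7MG F N Sup Adm B₃ a₀' a₁' :=
  fun ν M g K k s hk hsep hM₁ hAdm ε₀ δ hnum hcomp hcomp' hε W h7 =>
    h ν M g K k s hk hsep hM₁ hAdm ε₀ δ (fun n hn => ⟨(hnum n hn).1, (hnum n hn).2.1.trans ha₁, (hnum n hn).2.2⟩) hcomp hcomp' (hε.trans ha₀) W h7

/-- The guarded `CoP` fact is antitone in the ceilings. [cite: Balaban1985Variational, Thm 1 p.279 (bookkeeping)] -/
theorem VariationalThm1EUSepCoP7MG.of_le {Adm : StepGuard F} {B₃ a₀ a₀' a₁ a₁' : ℝ} (h : VariationalThm1EUSepCoP7MG F N Adm B₃ a₀ a₁) (ha₀ : a₀' ≤ a₀)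
    (ha₁ : a₁' ≤ a₁) : VariationalThm1EUSepCoP7MG F N Adm B₃ a₀' a₁' :=
  VariationalThm1EUSepTop7MG.of_le h ha₀ ha₁

/-- The guarded fact is ANTITONE IN THE GUARD: a fact stated under a weaker guard `Adm` (more indices admitted) yields the fact under any stronger guard `Adm'`.
[cite: Balaban1985Variational, Thm 1 p.279 (bookkeeping)] -/
theorem VariationalThm1EUSepTop7MG.anti {Sup : (ν : Stage7Numerics) → (K : ℕ) → (ℕ → Set (Site (F.P K) 0)) → Set (Site (F.P K) 0)} {Adm Adm' : StepGuard F}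
    {B₃ a₀ a₁ : ℝ} (h : VariationalThm1EUSepTop7MG F N Sup Adm B₃ a₀ a₁) (hAdm : ∀ ν M g K k s, Adm' ν M g K k s → Adm ν M g K k s) :
    VariationalThm1EUSepTop7MG F N Sup Adm' B₃ a₀ a₁ :=
  fun ν M g K k s hk hsep hM₁ hAdm' => h ν M g K k s hk hsep hM₁ (hAdm ν M g K k s hAdm')

/-- The guarded `CoP` fact is antitone in the guard. [cite: Balaban1985Variational, Thm 1 p.279 (bookkeeping)] -/
theorem VariationalThm1EUSepCoP7MG.anti {Adm Adm' : StepGuard F} {B₃ a₀ a₁ : ℝ} (h : VariationalThm1EUSepCoP7MG F N Adm B₃ a₀ a₁)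
    (hAdm : ∀ ν M g K k s, Adm' ν M g K k s → Adm ν M g K k s) : VariationalThm1EUSepCoP7MG F N Adm' B₃ a₀ a₁ :=
  VariationalThm1EUSepTop7MG.anti h hAdm

/-- At the TRIVIAL guard the guarded fact IS the floor-free fact. [cite: Balaban1985Variational, Thm 1 p.279 (bookkeeping)] -/
theorem variationalThm1EUSepTop7MG_true_iff {Sup : (ν : Stage7Numerics) → (K : ℕ) → (ℕ → Set (Site (F.P K) 0)) → Set (Site (F.P K) 0)} {B₃ a₀ a₁ : ℝ} :
    VariationalThm1EUSepTop7MG F N Sup (fun _ _ _ _ _ _ => True) B₃ a₀ a₁ ↔ B11Thm1ExistsUniqueCoP7M.VariationalThm1EUSepTop7M F N Sup B₃ a₀ a₁ :=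
  ⟨fun h ν M g K k s hk hsep hM₁ => h ν M g K k s hk hsep hM₁ trivial, fun h => h.toG _⟩

/-- At the trivial guard the guarded `CoP` fact IS the floor-free `CoP` fact ✓p740853. [cite: Balaban1985Variational, Thm 1 p.279 (bookkeeping)] -/
theorem variationalThm1EUSepCoP7MG_true_iff {B₃ a₀ a₁ : ℝ} :
    VariationalThm1EUSepCoP7MG F N (fun _ _ _ _ _ _ => True) B₃ a₀ a₁ ↔ B11Thm1ExistsUniqueCoP7M.VariationalThm1EUSepCoP7M F N B₃ a₀ a₁ :=
  variationalThm1EUSepTop7MG_true_iff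

end Bridges

end Literature.MathematicalPhysics.QuantumFieldTheory.Balaban1983to89.B11Thm1ExistsUniqueCoP7MG

end
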